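import Literature.Algebra.Homology.ExtLocalizationAdditive
import Literature.Algebra.Homology.DiscreteRepTrivialDuality
import Literature.Algebra.Homology.DiscreteRepOpenSubgroup
import HarnessLib

/-!
# Localisation maps on the permutation modules `Coind_U^Γ(k^m)`: reduction of the permutation-level
# inputs from `k^m` to `k` (additivity), and `Extⁿ(triv (ι → k), B) = 0` from `Extⁿ(triv k, B) = 0`

Topic `Algebra/Homology`; namespace `Literature.Algebra.Homology.DiscreteRep`.  One definition with body
(`coindDTrivFinSuccIso`) and theorems; no named fact, no instance, no `sorry`.  Sequel of
`ExtLocalizationAdditive` (bsd-eis -w4 g20: `locMap` injectivity / surjectivity are stable under `≅` and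
`⊞` in the source), `DiscreteRepTrivialDuality` (door-c4: `trivIso`, `trivProdIso`, `isZero_triv`,
`ext_eq_zero_of_isZero_left`) and `DiscreteRepOpenSubgroup` (`coindD`, additive).

* `coindDTrivFinSuccIso U hU m : Coind_U(k^{m+1}) ≅ Coind_U(k) ⊞ Coind_U(k^m)` (`Coind_U` is additive, `triv`
  commutes with `⊞`, `k^{m+1} ≃ k × k^m` by `Fin.consLinearEquiv`); `isZero_coindD_triv_fin_zero`.
* **`locMap_injective_coindD_fin` / `locMap_surjective_coindD_fin`**: for a family `(L i, q i)` of additive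
  exact functors / coefficient maps out of `C_Γ` (the data of `ExtLocalization.locMap`), injectivity (resp.
  surjectivity) of the localisation map on `Coind_U(k)` in degree `n` implies it on `Coind_U(k^m)` for all `m`.
* `ext_triv_fin_eq_zero`, `ext_triv_pi_eq_zero`, `ext_triv_pi_pi_eq_zero`: `Extⁿ_{C_Γ}(triv (ι → k), B) = 0`
  (and for `ι → ι' → k`) for finite `ι`, `ι'` as soon as `Extⁿ_{C_Γ}(triv k, B) = 0`.

USE (lane «PT-Ш-S-TC», crux `stmt-BirchSwinnertonDyer-19032`, brick (Λ)(e), file E4b of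
`LAMBDA-E-DEVISSAGE-w4g20.md`): the five hypotheses of `DiscreteRep.locMap_injective_two_of_permutation`
quantify over all `m`; with this file it suffices to establish them for `m = 1` (Milne I Lemma 4.13 /
Harari Prop. 17.25 are likewise additive in the module).  HONEST FRAMING: homological algebra only.

## References
* J. S. Milne, *Arithmetic Duality Theorems*, 2nd ed. (2006), I §0 and Lemma 4.13. [MilneADT2006]
* S. Mac Lane, *Homology*, Grundlehren 114 (1963), IX §1 (additive functors and biproducts). [MacLane1963Homology]
-/

noncomputable section

universe w' v' u' t

namespace Literature.Algebra.Homology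

namespace DiscreteRep

open CategoryTheory CategoryTheory.Limits CategoryTheory.Abelian

/-! ## §1 `Coind_U(k^{m+1}) ≅ Coind_U(k) ⊞ Coind_U(k^m)` -/

section Coind

variable {k Γ : Type} [CommRing k] [Group Γ] [TopologicalSpace Γ] [IsTopologicalGroup Γ]
  (U : Subgroup Γ) (hU : IsOpen (U : Set Γ)) [U.FiniteIndex]

/-- `triv (k^{m+1}) ≅ triv k ⊞ triv (k^m)` in `C_U`. [cite: MacLane1963Homology, IX §1] -/
def trivFinSuccIso (m : ℕ) :
    triv (k := k) (Γ := ↥U) (Fin (m + 1) → k) ≅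
      triv (k := k) (Γ := ↥U) k ⊞ triv (k := k) (Γ := ↥U) (Fin m → k) :=
  trivIso (Fin.consLinearEquiv k (fun _ : Fin (m + 1) => k)).symm ≪≫ trivProdIso k (Fin m → k)

/-- **`Coind_U(k^{m+1}) ≅ Coind_U(k) ⊞ Coind_U(k^m)`** (`Coind_U` additive). [cite: MacLane1963Homology, IX §1]
[cite: MilneADT2006, I §0] -/
def coindDTrivFinSuccIso (m : ℕ) :
    (coindD k U hU).obj (triv (k := k) (Γ := ↥U) (Fin (m + 1) → k)) ≅
      (coindD k U hU).obj (triv (k := k) (Γ := ↥U) k) ⊞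
        (coindD k U hU).obj (triv (k := k) (Γ := ↥U) (Fin m → k)) :=
  haveI : PreservesBinaryBiproducts (coindD k U hU) := preservesBinaryBiproducts_of_preservesBiproducts _
  (coindD k U hU).mapIso (trivFinSuccIso U m) ≪≫ (coindD k U hU).mapBiprod _ _

/-- `Coind_U(k^0)` is a zero object. [cite: MacLane1963Homology, IX §1] -/
theorem isZero_coindD_triv_fin_zero :
    IsZero ((coindD k U hU).obj (triv (k := k) (Γ := ↥U) (Fin 0 → k))) :=
  (coindD k U hU).map_isZero (isZero_triv (Fin 0 → k))

end Coind

/-! ## §2 The permutation-level inputs for all `m` from `m = 1` -/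

section LocMap

variable {k Γ : Type} [CommRing k] [Group Γ] [TopologicalSpace Γ] [IsTopologicalGroup Γ]
  (U : Subgroup Γ) (hU : IsOpen (U : Set Γ)) [U.FiniteIndex]
  {ι' : Type t} {D : ι' → Type u'} [∀ i, Category.{v'} (D i)] [∀ i, Abelian (D i)]
  [∀ i, HasExt.{w'} (D i)]
  (L : ∀ i, DiscreteRepCat k Γ ⥤ D i) [∀ i, (L i).Additive] [∀ i, PreservesFiniteLimits (L i)]
  [∀ i, PreservesFiniteColimits (L i)]
  {B : DiscreteRepCat k Γ} {Y : ∀ i, D i} (q : ∀ i, (L i).obj B ⟶ Y i)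

/-- On a zero object the localisation map is injective. [cite: MilneADT2006, I §0] -/
theorem locMap_injective_of_isZero {A : DiscreteRepCat k Γ} (hA : IsZero A) (n : ℕ) :
    Function.Injective (ExtLocalization.locMap L q A n) := fun x y _ => by
  rw [ext_eq_zero_of_isZero_left hA x, ext_eq_zero_of_isZero_left hA y]

/-- On a zero object the localisation map is surjective (the `L i` preserve zero objects).
[cite: MilneADT2006, I §0] -/
theorem locMap_surjective_of_isZero {A : DiscreteRepCat k Γ} (hA : IsZero A) (n : ℕ) :
    Function.Surjective (ExtLocalization.locMap L q A n) := fun y =>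
  ⟨0, by
    rw [map_zero]
    funext i
    exact (ext_eq_zero_of_isZero_left ((L i).map_isZero hA) (y i)).symm⟩

/-- **Injectivity on `Coind_U(k^m)` for all `m` from `Coind_U(k)`.** [cite: MilneADT2006, I Lemma 4.13]
[cite: MacLane1963Homology, IX §1] -/
theorem locMap_injective_coindD_fin (n : ℕ)
    (h : Function.Injective (ExtLocalization.locMap L q ((coindD k U hU).obj (triv (k := k) (Γ := ↥U) k)) n))
    (m : ℕ) :
    Function.Injective
      (ExtLocalization.locMap L q ((coindD k U hU).obj (triv (k := k) (Γ := ↥U) (Fin m → k))) n) := by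
  induction m with
  | zero => exact locMap_injective_of_isZero L q (isZero_coindD_triv_fin_zero U hU) n
  | succ m ih =>
    exact ExtLocalization.locMap_injective_of_iso L q (coindDTrivFinSuccIso U hU m).symm n
      (ExtLocalization.locMap_injective_biprod L q n h ih)

/-- **Surjectivity on `Coind_U(k^m)` for all `m` from `Coind_U(k)`.** [cite: MilneADT2006, I Lemma 4.13]
[cite: MacLane1963Homology, IX §1] -/
theorem locMap_surjective_coindD_fin (n : ℕ)
    (h : Function.Surjective (ExtLocalization.locMap L q ((coindD k U hU).obj (triv (k := k) (Γ := ↥U) k)) n))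
    (m : ℕ) :
    Function.Surjective
      (ExtLocalization.locMap L q ((coindD k U hU).obj (triv (k := k) (Γ := ↥U) (Fin m → k))) n) := by
  induction m with
  | zero => exact locMap_surjective_of_isZero L q (isZero_coindD_triv_fin_zero U hU) n
  | succ m ih =>
    exact ExtLocalization.locMap_surjective_of_iso L q (coindDTrivFinSuccIso U hU m).symm n
      (ExtLocalization.locMap_surjective_biprod L q n h ih)

end LocMap

/-! ## §3 `Extⁿ(triv (ι → k), B) = 0` from `Extⁿ(triv k, B) = 0` -/

section TrivPi

variable {k Δ : Type} [CommRing k] [Group Δ] [TopologicalSpace Δ] [IsTopologicalGroup Δ]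
  (B : DiscreteRepCat k Δ) (n : ℕ)

/-- Vanishing of `Ext(·, B)` transports along an isomorphism of the source. [cite: MilneADT2006, I §0] -/
theorem ext_eq_zero_of_iso_left {X X' : DiscreteRepCat k Δ} (e : X ≅ X') (h : ∀ z : Ext X B n, z = 0)
    (z : Ext X' B n) : z = 0 := by
  rw [← Ext.mk₀_id_comp z, ← e.inv_hom_id, ← Ext.mk₀_comp_mk₀_assoc, h ((Ext.mk₀ e.hom).comp z _),
    Ext.comp_zero]

/-- Vanishing of `Ext(·, B)` on a binary biproduct from vanishing on the summands.
[cite: MacLane1963Homology, IX §1] -/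
theorem ext_eq_zero_of_biprod_left {X₁ X₂ : DiscreteRepCat k Δ} (h₁ : ∀ z : Ext X₁ B n, z = 0)
    (h₂ : ∀ z : Ext X₂ B n, z = 0) (z : Ext (X₁ ⊞ X₂) B n) : z = 0 := by
  rw [ExtLocalization.ext_biprod_decomp n z, h₁ ((Ext.mk₀ biprod.inl).comp z _),
    h₂ ((Ext.mk₀ biprod.inr).comp z _), Ext.comp_zero, Ext.comp_zero, add_zero]

/-- **`Extⁿ(triv (k^m), B) = 0` from `Extⁿ(triv k, B) = 0`.** [cite: MilneADT2006, I §0, Lemma 4.13]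
[cite: MacLane1963Homology, IX §1] -/
theorem ext_triv_fin_eq_zero (h : ∀ z : Ext (triv (k := k) (Γ := Δ) k) B n, z = 0) (m : ℕ)
    (z : Ext (triv (k := k) (Γ := Δ) (Fin m → k)) B n) : z = 0 := by
  induction m with
  | zero => exact ext_eq_zero_of_isZero_left (isZero_triv (Fin 0 → k)) z
  | succ m ih =>
    exact ext_eq_zero_of_iso_left B n
      (trivIso (Fin.consLinearEquiv k (fun _ : Fin (m + 1) => k)).symm ≪≫ trivProdIso k (Fin m → k)).symm
      (ext_eq_zero_of_biprod_left B n h ih) z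

/-- **`Extⁿ(triv (ι → k), B) = 0` for `ι` finite.** [cite: MilneADT2006, I §0, Lemma 4.13] -/
theorem ext_triv_pi_eq_zero (h : ∀ z : Ext (triv (k := k) (Γ := Δ) k) B n, z = 0) (ι : Type) [Finite ι]
    (z : Ext (triv (k := k) (Γ := Δ) (ι → k)) B n) : z = 0 := by
  obtain ⟨m, ⟨e⟩⟩ := Finite.exists_equiv_fin ι
  exact ext_eq_zero_of_iso_left B n (trivIso (LinearEquiv.funCongrLeft k k e)) (ext_triv_fin_eq_zero B n h m) z

/-- **`Extⁿ(triv (ι → ι' → k), B) = 0` for `ι`, `ι'` finite** (uncurrying). [cite: MilneADT2006, I §0, Lemma 4.13] -/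
theorem ext_triv_pi_pi_eq_zero (h : ∀ z : Ext (triv (k := k) (Γ := Δ) k) B n, z = 0) (ι ι' : Type)
    [Finite ι] [Finite ι'] (z : Ext (triv (k := k) (Γ := Δ) (ι → ι' → k)) B n) : z = 0 :=
  ext_eq_zero_of_iso_left B n (trivIso (LinearEquiv.curry k k ι ι'))
    (ext_triv_pi_eq_zero B n h (ι × ι')) z

end TrivPi

end DiscreteRep

end Literature.Algebra.Homology

end
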